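import Summits.BirchSwinnertonDyer.BirchSwinnertonDyer.Theorems.TameQuarticSolventTprimeHodgeSplitAtThree
import Literature.NumberTheory.EllipticCurves.FormalGroupVerschiebungHasseZeroProofs
import Literature.NumberTheory.EllipticCurves.PadicSigmaThreeExistence
import Mathlib.Algebra.CharP.Quotient
import HarnessLib

/-!
# Route `TameQuarticSolvent`, crux `SolventPairLowerBound` (stmt-BirchSwinnertonDyer-21391) — the FORMAL-GROUP
# CONGRUENCE `[3](t) ≡ h(t⁹) (mod 3)` on the good model of a (t′) curve over the quartic ring holds EXACTLY in
# case B of the Hodge split (and fails at `t³` in case A)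

HONEST FRAMING. Theorems only; helper (`--supports stmt-BirchSwinnertonDyer-21391 --as helper`) of width seat
bsd-wall-tqs-p1-w3 g5, sequel of `TameQuarticSolventTprimeHodgeSplitAtThree` (p595856) and of the memo
`Cruxes/SolventPairLowerBound/TPRIME-LOCAL-SHAPE-w3g5.md`. It types the first LOCAL input any signed (±) Iwasawa
theory over the solvent quartic field `M` of line birth would use (child K1⁻ 23963): Kobayashi's congruence for the
multiplication-by-`3` series of the good formal group at the place `w ∣ 3`, `e(w|3) = 4`. BSD is not proved by any
of this; nothing here closes 21391 or 23963.

WHAT.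
* §1 (any commutative ring `O` in which `3` is not a unit) `coeff_formalMul_three_mem_span_of_three_dvd_a₂` — for a
  square-completed model `y² = x³ + a₂x² + a₄x + a₆` with `3 ∣ a₂` EVERY coefficient of `[3](t) = Σ cₙtⁿ` with `9 ∤ n`
  lies in `3O`, i.e. `[3](t) ≡ h(t⁹) (mod 3)`: the reduction mod `3` has Hasse invariant `4a₂ ≡ 0` (Deuring, tree
  `hasseCoeff_three_of_isCharNeTwoNF`), so the tree's lift of Lazard's lemma for the Verschiebung
  (`coeff_formalMul_prime_mem_of_hasseCoeff_reduction_eq_zero`, Serre 1967 §5 Lemme 3's hypothesis) applies. And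
  `coeff_three_formalMul_three_sub_mem_span` — for every square-completed model `c₃ ≡ 4a₂ (mod 3)` (tree
  `coeff_prime_formalMul_sub_hasseCoeff_mem_span`, Katz–Mazur 12.4.2): the congruence FAILS at `t³` as soon as
  `4a₂ ∉ 3O`.
* §2 (the good model of a (t′) curve over a ring `O` with `3 = ϖ⁴u`, `u ∈ Oˣ` — e.g. `O = 𝓞_{M,w}`, `ϖ` a
  uniformiser) from the `ℤ₃` MEDIUM FORM `S = y² = x³ + A₂x² + A₄x + A₆` of type `III` (`3 ∣ A₂`, `3 ∣ A₄`, `9 ∣ A₆`,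
  `ord Δ = 3`): the `ϖ`-RESCALED model `W' = (A₂/ϖ², A₄/ϖ⁴, A₆/ϖ⁶)` exists over `O`, has `Δ(W') = u³·φ(Δ(S)/27)` a UNIT
  (good reduction, the explicit Serre–Tate descent of p571347 in coefficient form), and
  - CASE B (`9 ∣ A₂`): `3 ∣ a₂(W')`, hence `[3]_{W'}(t) ≡ h(t⁹) (mod 3O)` (`tprime_caseB_goodModel_formalMul_three`);
  - CASE A (`9 ∤ A₂`): `a₂(W') = ϖ²·u·φ(A₂/3)` with `A₂/3 ∈ ℤ₃ˣ`, hence `c₃([3]_{W'}) ≡ 4uϖ²·φ(A₂/3) (mod 3O)` — of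
    `ϖ`-order exactly `2 < 4` whenever `ϖ` is a non-unit prime of `O` (`tprime_caseA_goodModel_coeff_three`).
  Type `III*` is identical with `(ϖ³, A₂/ϖ⁶, A₄/ϖ¹², A₆/ϖ¹⁸)` (`…IIIstar`).
* The `ℚ`-level dichotomy (from `Addv W 3`, `SubTprime W 3`) is the sequel file
  `TameQuarticSolventTprimeFormalGroupDichotomyAtThree`.

References: J. H. Silverman, *AEC* IV.4.4, IV.7.5, VII.1; N. M. Katz, B. Mazur, *Arithmetic Moduli* 12.4.2; J.-P.
Serre, Driebergen 1966 §5 Lemme 3; S. Kobayashi, Invent. Math. 152 (2003) §8 (the congruence `[p] ≡ t^{p²}` behind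
the ± decomposition). [cite: SilvermanAEC2009, IV.7.5] [cite: Serre1967GroupesPDivisibles, §5 Lemme 3]
-/

-- D-0017: single-problem summit, so `Summit.BirchSwinnertonDyer.BirchSwinnertonDyer.…` repeats a namespace BY DESIGN.
set_option linter.dupNamespace false

noncomputable section

open IsLocalRing IsDedekindDomain
open IsDiscreteValuationRing hiding maximalIdeal
open Literature Literature.NumberTheory.DiophantineGeometry
  Literature.NumberTheory.DiophantineGeometry.TateAlgorithm
  Literature.NumberTheory.EllipticCurves

namespace Summit.BirchSwinnertonDyer.BirchSwinnertonDyer.Theorems.SolventPairLowerBound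

/-! ## §1 Square-completed models over a ring in which `3` is not a unit -/

section AnyRing

variable {O : Type*} [CommRing O]

/-- **Kobayashi's congruence from `3 ∣ a₂`.** Over a commutative ring `O` in which `3` is not a unit, a
square-completed model `y² = x³ + a₂x² + a₄x + a₆` with `3 ∣ a₂` has `[3](t) ≡ h(t⁹) (mod 3O)`: every coefficient
`cₙ` of the multiplication-by-`3` series with `9 ∤ n` lies in `3O`. (Hasse invariant of the reduction
`= 4a₂ ≡ 0`, then Lazard for the Verschiebung, lifted: tree `coeff_formalMul_prime_mem_of_hasseCoeff_reduction_eq_zero`.)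
[cite: Serre1967GroupesPDivisibles, §5 Lemme 3] [cite: SilvermanAEC2009, IV.7.5] -/
theorem coeff_formalMul_three_mem_span_of_three_dvd_a₂ (h3 : (3 : O) ∈ nonunits O)
    (W : WeierstrassCurve O) (h₁ : W.a₁ = 0) (h₃ : W.a₃ = 0) (h₂ : (3 : O) ∣ W.a₂)
    {n : ℕ} (hn : ¬ 9 ∣ n) : PowerSeries.coeff n (W.formalMul 3) ∈ Ideal.span {(3 : O)} := by
  haveI : Fact (Nat.Prime 3) := ⟨Nat.prime_three⟩
  set I : Ideal O := Ideal.span {((3 : ℕ) : O)} with hI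
  have h3' : ((3 : ℕ) : O) ∈ nonunits O := by simpa using h3
  haveI : CharP (O ⧸ I) 3 := CharP.quotient O 3 h3'
  haveI : (W.map (Ideal.Quotient.mk I)).IsCharNeTwoNF :=
    ⟨by simp [WeierstrassCurve.map_a₁, h₁], by simp [WeierstrassCurve.map_a₃, h₃]⟩
  have hA : (W.map (Ideal.Quotient.mk I)).hasseCoeff 3 = 0 := by
    rw [PadicSigmaThree.hasseCoeff_three_of_isCharNeTwoNF, WeierstrassCurve.map_a₂,
      ← map_ofNat (Ideal.Quotient.mk I) 4, ← map_mul, Ideal.Quotient.eq_zero_iff_mem]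
    refine Ideal.mul_mem_left _ _ ?_
    rw [hI, Ideal.mem_span_singleton]
    simpa using h₂
  have h := W.coeff_formalMul_prime_mem_of_hasseCoeff_reduction_eq_zero 3 I (by norm_num) hA
    (n := n) (by simpa using hn)
  simpa [hI] using h

/-- **`c₃ ≡ 4a₂ (mod 3)` for a square-completed model.** Over any commutative ring, the `t³`-coefficient of the
multiplication-by-`3` series of `y² = x³ + a₂x² + a₄x + a₆` is `≡ 4a₂ (mod 3)` (the Verschiebung's linear term
is the Hasse invariant: tree `coeff_prime_formalMul_sub_hasseCoeff_mem_span`, and `A₃ = b₂ = 4a₂`). So if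
`4a₂ ∉ 3O` the congruence `[3] ≡ h(t⁹) (mod 3)` fails at `t³`. [cite: SilvermanAEC2009, IV.4.4] -/
theorem coeff_three_formalMul_three_sub_mem_span (W : WeierstrassCurve O) (h₁ : W.a₁ = 0) (h₃ : W.a₃ = 0) :
    PowerSeries.coeff 3 (W.formalMul 3) - 4 * W.a₂ ∈ Ideal.span {(3 : O)} := by
  haveI : Fact (Nat.Prime 3) := ⟨Nat.prime_three⟩
  haveI : W.IsCharNeTwoNF := ⟨h₁, h₃⟩
  have h := WeierstrassCurve.coeff_prime_formalMul_sub_hasseCoeff_mem_span 3 W (by norm_num)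
  rw [PadicSigmaThree.hasseCoeff_three_of_isCharNeTwoNF] at h
  simpa using h

end AnyRing

/-! ## §2 The good model of a (t′) curve over a ring with `3 = ϖ⁴u` -/

section GoodModel

/-- In `ℤ₃`: if `ord x = 3` and `x = 27·P` then `P` is a unit (else `3⁴ ∣ x`). [folklore] -/
theorem isUnit_of_addVal_eq_three_of_eq_27_mul {x P : ℤ_[3]} (hx : (addVal ℤ_[3] x).toNat = 3)
    (h : x = 27 * P) : IsUnit P := by
  have h3 : Irreducible (3 : ℤ_[3]) := by simpa using PadicInt.irreducible_p (p := 3)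
  have hx0 : x ≠ 0 := by
    rintro rfl
    simp at hx
  rw [isUnit_iff_not_dvd h3]
  rintro ⟨q, rfl⟩
  have h81 : (3 : ℤ_[3]) ^ 4 ∣ x := ⟨q, by rw [h]; ring⟩
  have := le_addVal_toNat_of_pow_dvd h3 hx0 h81
  omega

/-- In `ℤ₃`: if `ord x = 9` and `x = 3⁹·P` then `P` is a unit (else `3¹⁰ ∣ x`). [folklore] -/
theorem isUnit_of_addVal_eq_nine_of_eq_mul {x P : ℤ_[3]} (hx : (addVal ℤ_[3] x).toNat = 9)
    (h : x = 3 ^ 9 * P) : IsUnit P := by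
  have h3 : Irreducible (3 : ℤ_[3]) := by simpa using PadicInt.irreducible_p (p := 3)
  have hx0 : x ≠ 0 := by
    rintro rfl
    simp at hx
  rw [isUnit_iff_not_dvd h3]
  rintro ⟨q, rfl⟩
  have h10 : (3 : ℤ_[3]) ^ 10 ∣ x := ⟨q, by rw [h]; ring⟩
  have := le_addVal_toNat_of_pow_dvd h3 hx0 h10
  omega

variable {O : Type*} [CommRing O] (φ : ℤ_[3] →+* O) {ϖ u : O}

/-- `3 = ϖ⁴u` with `ϖ` a non-unit makes `3` a non-unit of `O`. [folklore] -/
theorem three_mem_nonunits_of_eq (h3 : (3 : O) = ϖ ^ 4 * u) (hϖ : ¬ IsUnit ϖ) : (3 : O) ∈ nonunits O := by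
  rw [mem_nonunits_iff, h3]
  intro h
  exact hϖ ((isUnit_pow_iff (by norm_num)).mp (isUnit_of_mul_isUnit_left h))

/-- **Discriminant of the square-completed model** `y² = x³ + a₂x² + a₄x + a₆`:
`Δ = 16(−4a₂³a₆ + a₂²a₄² + 18a₂a₄a₆ − 4a₄³ − 27a₆²)`. Silverman *AEC* III.1. [cite: SilvermanAEC2009, III.1] -/
theorem Δ_eq_of_a₁_a₃_eq_zero {R : Type*} [CommRing R] (W : WeierstrassCurve R) (h₁ : W.a₁ = 0)
    (h₃ : W.a₃ = 0) :
    W.Δ = 16 * (-(4 * W.a₂ ^ 3 * W.a₆) + W.a₂ ^ 2 * W.a₄ ^ 2 + 18 * W.a₂ * W.a₄ * W.a₆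
      - 4 * W.a₄ ^ 3 - 27 * W.a₆ ^ 2) := by
  simp only [WeierstrassCurve.Δ, WeierstrassCurve.b₂, WeierstrassCurve.b₄, WeierstrassCurve.b₆,
    WeierstrassCurve.b₈, h₁, h₃]
  ring

/-- **Case B, type `III`: the good model over the quartic ring satisfies Kobayashi's congruence.** Let
`φ : ℤ₃ → O`, `3 = ϖ⁴u` in `O` with `u ∈ Oˣ` and `ϖ ∉ Oˣ` (e.g. `O = 𝓞_{M,w}`, `e(w|3) = 4`). Let `S/ℤ₃` be a
medium form of type `III` in CASE B: `a₁ = a₃ = 0`, `9 ∣ A₂`, `3 ∣ A₄`, `9 ∣ A₆`, `ord Δ(S) = 3`. Then the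
`ϖ`-RESCALED model `W' = (A₂/ϖ², A₄/ϖ⁴, A₆/ϖ⁶)` exists over `O` (`ϖ^{2i}·aᵢ(W') = φ(Aᵢ)`), has UNIT discriminant
(good reduction), `3 ∣ a₂(W')`, and `[3]_{W'}(t) ≡ h(t⁹) (mod 3O)`. [cite: SilvermanAEC2009, VII.1 and IV.7.5]
[cite: Serre1967GroupesPDivisibles, §5 Lemme 3] -/
theorem tprime_caseB_goodModel_formalMul_three (hu : IsUnit u) (h3 : (3 : O) = ϖ ^ 4 * u)
    (hϖ : ¬ IsUnit ϖ) (S : WeierstrassCurve ℤ_[3]) (h₁ : S.a₁ = 0) (h₃ : S.a₃ = 0)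
    (h₂ : (3 : ℤ_[3]) ^ 2 ∣ S.a₂) (h₄ : (3 : ℤ_[3]) ∣ S.a₄) (h₆ : (3 : ℤ_[3]) ^ 2 ∣ S.a₆)
    (hΔ : (addVal ℤ_[3] S.Δ).toNat = 3) :
    ∃ W' : WeierstrassCurve O, W'.a₁ = 0 ∧ W'.a₃ = 0 ∧
      ϖ ^ 2 * W'.a₂ = φ S.a₂ ∧ ϖ ^ 4 * W'.a₄ = φ S.a₄ ∧ ϖ ^ 6 * W'.a₆ = φ S.a₆ ∧
      IsUnit W'.Δ ∧ (3 : O) ∣ W'.a₂ ∧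
      ∀ n : ℕ, ¬ 9 ∣ n → PowerSeries.coeff n (W'.formalMul 3) ∈ Ideal.span {(3 : O)} := by
  obtain ⟨s, hs⟩ := h₂
  obtain ⟨t, ht⟩ := h₄
  obtain ⟨w, hw⟩ := h₆
  -- `Δ(S) = 27·P`, `P` a unit of `ℤ₃`
  set P : ℤ_[3] := 16 * (-(972 * s ^ 3 * w) + 27 * s ^ 2 * t ^ 2 + 162 * s * t * w - 4 * t ^ 3
    - 81 * w ^ 2) with hPdef
  have hSΔ : S.Δ = 27 * P := by
    rw [Δ_eq_of_a₁_a₃_eq_zero S h₁ h₃, hs, ht, hw, hPdef]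
    ring
  have hPu : IsUnit P := isUnit_of_addVal_eq_three_of_eq_27_mul hΔ hSΔ
  -- numerals divisible by `3` in `O`
  have e9 : (9 : O) = (ϖ ^ 4 * u) ^ 2 := by rw [← h3]; norm_num
  have e27 : (27 : O) = (ϖ ^ 4 * u) ^ 3 := by rw [← h3]; norm_num
  have e81 : (81 : O) = (ϖ ^ 4 * u) ^ 4 := by rw [← h3]; norm_num
  have e162 : (162 : O) = 2 * (ϖ ^ 4 * u) ^ 4 := by rw [← h3]; norm_num
  have e972 : (972 : O) = 4 * (ϖ ^ 4 * u) ^ 5 := by rw [← h3]; norm_num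
  have e18 : (18 : O) = 2 * (ϖ ^ 4 * u) ^ 2 := by rw [← h3]; norm_num
  set W' : WeierstrassCurve O := ⟨0, ϖ ^ 6 * u ^ 2 * φ s, 0, u * φ t, ϖ ^ 2 * u ^ 2 * φ w⟩ with hW'
  have hφ3 : φ 3 = ϖ ^ 4 * u := by rw [map_ofNat, h3]
  refine ⟨W', rfl, rfl, ?_, ?_, ?_, ?_, ?_, ?_⟩
  · rw [hs, map_mul, map_pow, hφ3]
    ring
  · rw [ht, map_mul, hφ3]
    ring
  · rw [hw, map_mul, map_pow, hφ3]
    ring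
  · -- `Δ(W') = u³·φ(P)`
    have hΔ' : W'.Δ = u ^ 3 * φ P := by
      rw [Δ_eq_of_a₁_a₃_eq_zero W' rfl rfl, hPdef]
      simp only [hW', map_mul, map_add, map_sub, map_neg, map_pow, map_ofNat]
      rw [e18, e27, e81, e162, e972]
      ring
    rw [hΔ']
    exact (hu.pow 3).mul (hPu.map φ)
  · exact ⟨ϖ ^ 2 * u * φ s, by rw [h3]; ring⟩
  · intro n hn
    exact coeff_formalMul_three_mem_span_of_three_dvd_a₂ (three_mem_nonunits_of_eq h3 hϖ) W' rfl rfl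
      ⟨ϖ ^ 2 * u * φ s, by rw [h3]; ring⟩ hn

/-- **Case A, type `III`: the congruence fails at `t³`.** Same setting, `S` a medium form of type `III` in
CASE A: `3 ∣ A₂`, `9 ∤ A₂`, `3 ∣ A₄`, `9 ∣ A₆`, `ord Δ(S) = 3`. Then the `ϖ`-rescaled model `W'` exists over `O`
with unit discriminant, `a₂(W') = ϖ²·s₀` with `s₀ ∈ Oˣ` (so its Hasse invariant `4a₂(W')` has `ϖ`-order `2`:
Hodge height `1/2`), and `c₃([3]_{W'}) ≡ 4a₂(W') (mod 3O)`. [cite: SilvermanAEC2009, IV.4.4 and VII.1] -/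
theorem tprime_caseA_goodModel_coeff_three (hu : IsUnit u) (h3 : (3 : O) = ϖ ^ 4 * u)
    (S : WeierstrassCurve ℤ_[3]) (h₁ : S.a₁ = 0) (h₃ : S.a₃ = 0)
    (h₂ : (3 : ℤ_[3]) ∣ S.a₂) (h₂' : ¬ (3 : ℤ_[3]) ^ 2 ∣ S.a₂) (h₄ : (3 : ℤ_[3]) ∣ S.a₄)
    (h₆ : (3 : ℤ_[3]) ^ 2 ∣ S.a₆) (hΔ : (addVal ℤ_[3] S.Δ).toNat = 3) :
    ∃ W' : WeierstrassCurve O, W'.a₁ = 0 ∧ W'.a₃ = 0 ∧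
      ϖ ^ 2 * W'.a₂ = φ S.a₂ ∧ ϖ ^ 4 * W'.a₄ = φ S.a₄ ∧ ϖ ^ 6 * W'.a₆ = φ S.a₆ ∧
      IsUnit W'.Δ ∧ (∃ s₀ : O, IsUnit s₀ ∧ W'.a₂ = ϖ ^ 2 * s₀) ∧
      PowerSeries.coeff 3 (W'.formalMul 3) - 4 * W'.a₂ ∈ Ideal.span {(3 : O)} := by
  have h3i : Irreducible (3 : ℤ_[3]) := by simpa using PadicInt.irreducible_p (p := 3)
  obtain ⟨s, hs⟩ := h₂
  obtain ⟨t, ht⟩ := h₄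
  obtain ⟨w, hw⟩ := h₆
  have hsu : IsUnit s := by
    rw [isUnit_iff_not_dvd h3i]
    rintro ⟨s', rfl⟩
    exact h₂' ⟨s', by rw [hs]; ring⟩
  set P : ℤ_[3] := 16 * (-(36 * s ^ 3 * w) + 3 * s ^ 2 * t ^ 2 + 54 * s * t * w - 4 * t ^ 3
    - 81 * w ^ 2) with hPdef
  have hSΔ : S.Δ = 27 * P := by
    rw [Δ_eq_of_a₁_a₃_eq_zero S h₁ h₃, hs, ht, hw, hPdef]
    ring
  have hPu : IsUnit P := isUnit_of_addVal_eq_three_of_eq_27_mul hΔ hSΔ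
  have e18 : (18 : O) = 2 * (ϖ ^ 4 * u) ^ 2 := by rw [← h3]; norm_num
  have e27 : (27 : O) = (ϖ ^ 4 * u) ^ 3 := by rw [← h3]; norm_num
  have e36 : (36 : O) = 4 * (ϖ ^ 4 * u) ^ 2 := by rw [← h3]; norm_num
  have e54 : (54 : O) = 2 * (ϖ ^ 4 * u) ^ 3 := by rw [← h3]; norm_num
  have e81 : (81 : O) = (ϖ ^ 4 * u) ^ 4 := by rw [← h3]; norm_num
  set W' : WeierstrassCurve O := ⟨0, ϖ ^ 2 * u * φ s, 0, u * φ t, ϖ ^ 2 * u ^ 2 * φ w⟩ with hW'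
  have hφ3 : φ 3 = ϖ ^ 4 * u := by rw [map_ofNat, h3]
  refine ⟨W', rfl, rfl, ?_, ?_, ?_, ?_, ⟨u * φ s, hu.mul (hsu.map φ), by rw [hW']; ring⟩, ?_⟩
  · rw [hs, map_mul, hφ3]
    ring
  · rw [ht, map_mul, hφ3]
    ring
  · rw [hw, map_mul, map_pow, hφ3]
    ring
  · have hΔ' : W'.Δ = u ^ 3 * φ P := by
      rw [Δ_eq_of_a₁_a₃_eq_zero W' rfl rfl, hPdef]
      simp only [hW', map_mul, map_add, map_sub, map_neg, map_pow, map_ofNat]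
      rw [e18, e27, e36, e54, e81, h3]
      ring
    rw [hΔ']
    exact (hu.pow 3).mul (hPu.map φ)
  · exact coeff_three_formalMul_three_sub_mem_span W' rfl rfl

/-- **Case B, type `III*`: Kobayashi's congruence on the good model.** Same setting, `S` a medium form of
type `III*` in CASE B: `27 ∣ A₂`, `27 ∣ A₄`, `3⁵ ∣ A₆`, `ord Δ(S) = 9`; the rescaling is by `ϖ³`
(`ϖ^{6i/2}·aᵢ(W') = φ(Aᵢ)`). [cite: SilvermanAEC2009, VII.1 and IV.7.5]
[cite: Serre1967GroupesPDivisibles, §5 Lemme 3] -/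
theorem tprime_caseB_goodModel_formalMul_three_IIIstar (hu : IsUnit u) (h3 : (3 : O) = ϖ ^ 4 * u)
    (hϖ : ¬ IsUnit ϖ) (S : WeierstrassCurve ℤ_[3]) (h₁ : S.a₁ = 0) (h₃ : S.a₃ = 0)
    (h₂ : (3 : ℤ_[3]) ^ 3 ∣ S.a₂) (h₄ : (3 : ℤ_[3]) ^ 3 ∣ S.a₄) (h₆ : (3 : ℤ_[3]) ^ 5 ∣ S.a₆)
    (hΔ : (addVal ℤ_[3] S.Δ).toNat = 9) :
    ∃ W' : WeierstrassCurve O, W'.a₁ = 0 ∧ W'.a₃ = 0 ∧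
      ϖ ^ 6 * W'.a₂ = φ S.a₂ ∧ ϖ ^ 12 * W'.a₄ = φ S.a₄ ∧ ϖ ^ 18 * W'.a₆ = φ S.a₆ ∧
      IsUnit W'.Δ ∧ (3 : O) ∣ W'.a₂ ∧
      ∀ n : ℕ, ¬ 9 ∣ n → PowerSeries.coeff n (W'.formalMul 3) ∈ Ideal.span {(3 : O)} := by
  obtain ⟨s, hs⟩ := h₂
  obtain ⟨t, ht⟩ := h₄
  obtain ⟨w, hw⟩ := h₆
  set P : ℤ_[3] := 16 * (-(972 * s ^ 3 * w) + 27 * s ^ 2 * t ^ 2 + 162 * s * t * w - 4 * t ^ 3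
    - 81 * w ^ 2) with hPdef
  have hSΔ : S.Δ = 3 ^ 9 * P := by
    rw [Δ_eq_of_a₁_a₃_eq_zero S h₁ h₃, hs, ht, hw, hPdef]
    ring
  have hPu : IsUnit P := isUnit_of_addVal_eq_nine_of_eq_mul hΔ hSΔ
  have e18 : (18 : O) = 2 * (ϖ ^ 4 * u) ^ 2 := by rw [← h3]; norm_num
  have e27 : (27 : O) = (ϖ ^ 4 * u) ^ 3 := by rw [← h3]; norm_num
  have e81 : (81 : O) = (ϖ ^ 4 * u) ^ 4 := by rw [← h3]; norm_num
  have e162 : (162 : O) = 2 * (ϖ ^ 4 * u) ^ 4 := by rw [← h3]; norm_num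
  have e972 : (972 : O) = 4 * (ϖ ^ 4 * u) ^ 5 := by rw [← h3]; norm_num
  set W' : WeierstrassCurve O := ⟨0, ϖ ^ 6 * u ^ 3 * φ s, 0, u ^ 3 * φ t, ϖ ^ 2 * u ^ 5 * φ w⟩
    with hW'
  have hφ3 : φ 3 = ϖ ^ 4 * u := by rw [map_ofNat, h3]
  refine ⟨W', rfl, rfl, ?_, ?_, ?_, ?_, ?_, ?_⟩
  · rw [hs, map_mul, map_pow, hφ3]
    ring
  · rw [ht, map_mul, map_pow, hφ3]
    ring
  · rw [hw, map_mul, map_pow, hφ3]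
    ring
  · have hΔ' : W'.Δ = u ^ 9 * φ P := by
      rw [Δ_eq_of_a₁_a₃_eq_zero W' rfl rfl, hPdef]
      simp only [hW', map_mul, map_add, map_sub, map_neg, map_pow, map_ofNat]
      rw [e18, e27, e81, e162, e972]
      ring
    rw [hΔ']
    exact (hu.pow 9).mul (hPu.map φ)
  · exact ⟨ϖ ^ 2 * u ^ 2 * φ s, by rw [h3]; ring⟩
  · intro n hn
    exact coeff_formalMul_three_mem_span_of_three_dvd_a₂ (three_mem_nonunits_of_eq h3 hϖ) W' rfl rfl
      ⟨ϖ ^ 2 * u ^ 2 * φ s, by rw [h3]; ring⟩ hn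

/-- **Case A, type `III*`: the congruence fails at `t³`.** Same setting, `S` a medium form of type `III*` in
CASE A: `9 ∣ A₂`, `27 ∤ A₂`, `27 ∣ A₄`, `3⁵ ∣ A₆`, `ord Δ(S) = 9`. [cite: SilvermanAEC2009, IV.4.4 and VII.1] -/
theorem tprime_caseA_goodModel_coeff_three_IIIstar (hu : IsUnit u) (h3 : (3 : O) = ϖ ^ 4 * u)
    (S : WeierstrassCurve ℤ_[3]) (h₁ : S.a₁ = 0) (h₃ : S.a₃ = 0)
    (h₂ : (3 : ℤ_[3]) ^ 2 ∣ S.a₂) (h₂' : ¬ (3 : ℤ_[3]) ^ 3 ∣ S.a₂) (h₄ : (3 : ℤ_[3]) ^ 3 ∣ S.a₄)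
    (h₆ : (3 : ℤ_[3]) ^ 5 ∣ S.a₆) (hΔ : (addVal ℤ_[3] S.Δ).toNat = 9) :
    ∃ W' : WeierstrassCurve O, W'.a₁ = 0 ∧ W'.a₃ = 0 ∧
      ϖ ^ 6 * W'.a₂ = φ S.a₂ ∧ ϖ ^ 12 * W'.a₄ = φ S.a₄ ∧ ϖ ^ 18 * W'.a₆ = φ S.a₆ ∧
      IsUnit W'.Δ ∧ (∃ s₀ : O, IsUnit s₀ ∧ W'.a₂ = ϖ ^ 2 * s₀) ∧
      PowerSeries.coeff 3 (W'.formalMul 3) - 4 * W'.a₂ ∈ Ideal.span {(3 : O)} := by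
  have h3i : Irreducible (3 : ℤ_[3]) := by simpa using PadicInt.irreducible_p (p := 3)
  obtain ⟨s, hs⟩ := h₂
  obtain ⟨t, ht⟩ := h₄
  obtain ⟨w, hw⟩ := h₆
  have hsu : IsUnit s := by
    rw [isUnit_iff_not_dvd h3i]
    rintro ⟨s', rfl⟩
    exact h₂' ⟨s', by rw [hs]; ring⟩
  set P : ℤ_[3] := 16 * (-(36 * s ^ 3 * w) + 3 * s ^ 2 * t ^ 2 + 54 * s * t * w - 4 * t ^ 3
    - 81 * w ^ 2) with hPdef
  have hSΔ : S.Δ = 3 ^ 9 * P := by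
    rw [Δ_eq_of_a₁_a₃_eq_zero S h₁ h₃, hs, ht, hw, hPdef]
    ring
  have hPu : IsUnit P := isUnit_of_addVal_eq_nine_of_eq_mul hΔ hSΔ
  have e18 : (18 : O) = 2 * (ϖ ^ 4 * u) ^ 2 := by rw [← h3]; norm_num
  have e27 : (27 : O) = (ϖ ^ 4 * u) ^ 3 := by rw [← h3]; norm_num
  have e36 : (36 : O) = 4 * (ϖ ^ 4 * u) ^ 2 := by rw [← h3]; norm_num
  have e54 : (54 : O) = 2 * (ϖ ^ 4 * u) ^ 3 := by rw [← h3]; norm_num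
  have e81 : (81 : O) = (ϖ ^ 4 * u) ^ 4 := by rw [← h3]; norm_num
  set W' : WeierstrassCurve O := ⟨0, ϖ ^ 2 * u ^ 2 * φ s, 0, u ^ 3 * φ t, ϖ ^ 2 * u ^ 5 * φ w⟩
    with hW'
  have hφ3 : φ 3 = ϖ ^ 4 * u := by rw [map_ofNat, h3]
  refine ⟨W', rfl, rfl, ?_, ?_, ?_, ?_, ⟨u ^ 2 * φ s, (hu.pow 2).mul (hsu.map φ), by rw [hW']; ring⟩,
    ?_⟩
  · rw [hs, map_mul, map_pow, hφ3]
    ring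
  · rw [ht, map_mul, map_pow, hφ3]
    ring
  · rw [hw, map_mul, map_pow, hφ3]
    ring
  · have hΔ' : W'.Δ = u ^ 9 * φ P := by
      rw [Δ_eq_of_a₁_a₃_eq_zero W' rfl rfl, hPdef]
      simp only [hW', map_mul, map_add, map_sub, map_neg, map_pow, map_ofNat]
      rw [e18, e27, e36, e54, e81, h3]
      ring
    rw [hΔ']
    exact (hu.pow 9).mul (hPu.map φ)
  · exact coeff_three_formalMul_three_sub_mem_span W' rfl rfl

end GoodModel


end Summit.BirchSwinnertonDyer.BirchSwinnertonDyer.Theorems.SolventPairLowerBound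

end
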